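import Literature.MathematicalPhysics.QuantumFieldTheory.Balaban1983to89.Setup
import HarnessLib

/-!
# S2β · (REG-UP)′ bridge (O2-b3-β3b, abstract part) — «THE TELESCOPE OF TWO COMPOSITE LINEAR TOWERS BY SEGMENT ROWS»: `A_{0→k} − B_{0→k} = Σ_i A_{i+1→k}∘(A_i − B_i)∘B_{0→i}` priced with
# SEGMENT rows `Λ_A·L^{k−i−1}` (K-uniform), one-step differences `β_i` and prefix rows `Λ_B(i)`: `‖A_{0→k} Y c − B_{0→k} Y c‖ ≤ (Σ_{i<k} Λ_A·L^{k−1−i}·β_i·Λ_B(i))·sup‖Y‖`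
# (px13 g29 ✓p840433 `norm_sub_segment_le` for a general normed value group, `X i := B_{0→i} Y`)

Cell `ym3-torus` (YM ladder rung R3 = continuum `SU(2)` Yang–Mills on the three-torus at fixed lattice data — a RUNG: NOT d = 4, NOT infinite volume, NOT a mass gap,
NOT Clay).  Width seat «width 12» `ym3-torus-px12` (gen 27); crux `stmt-QuantumFields-20520`, LINE g18-1 S2β, node (REG-UP)′ (hDcov assembly; the `hLip` letter of ✓(O2-b3-α) is this
telescope instantiated at `A_i = Dψ_{Ū^iU}`, `B_i = Dψ_{Ū^iU′}` with ✓(β2) differences, ✓p840392∕✓p840499 segment rows and ✓(D2) prefix rows).  `--kind proof --supports stmt-QuantumFields-20520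
--as helper`, count-neutral, DEFINITION-FREE (0 `def`, 0 `instance`, 0 `notation`, 0 `sorry`, default heartbeats).  Generic `P : Params`, values in any `SeminormedAddCommGroup E`.

WHAT IS PROVED (sorry-free).  ★★`norm_sub_telescope_le` — data: one-step maps `A B : (i : ℕ) → (PBond P i → E) → (PBond P (i+1) → E)`, segment composites of `A`,
`Aseg : (i k : ℕ) → (PBond P i → E) → (PBond P k → E)` with (hsegadd) additivity, (hseg) rows `(∀ b, ‖Z b‖ ≤ s) → ‖Aseg i k Z c‖ ≤ Λ·L^{k−i}·s`, (hsegsucc) `Aseg i k Z = Aseg (i+1) k (A i Z)`,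
(hsegkk) `Aseg k k Z = Z`; prefix composites of `B`, `Bk : (i : ℕ) → (PBond P 0 → E) → (PBond P i → E)` with (hBks) `Bk (i+1) Y = B i (Bk i Y)` and rows (hBrow) `‖Bk i Y b‖ ≤ ΛB i·s`;
one-step differences (hdiff) `(∀ b, ‖Z b‖ ≤ t) → ‖A i Z c − B i Z c‖ ≤ β i·t`.  Conclusion: `‖Aseg 0 k (Bk 0 Y) c − Bk k Y c‖ ≤ Σ_{i<k} Λ·L^{k−1−i}·(β i·(ΛB i·s))`.
★`norm_sub_telescope_le'` — the same with `Bk 0 Y = Y` substituted.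

HONEST SCOPE.  Bookkeeping (px13 g29's descending induction, verbatim pattern); nothing of Bałaban's renormalisation-group analysis proved ([Balaban1985Averaging] Prop. 4 (128)–(131) is the printed
locus); the instantiation, (hNL)∕(REG-UP)′∕GAP♯∘ (`stub_uniformFibreGapOrbit`, registry 3732b7df UNTOUCHED, 0∕5), the five registered stubs, S2β, crux 20520, 19936, 19200, `YM3TorusSU2` — NOT
proved; rung R3 — NOT d = 4, NOT infinite volume, NOT a mass gap, NOT Clay; the Yang–Mills mass gap is NOT proved.
-/

set_option autoImplicit false

namespace Summit.QuantumFields.YangMills.Theorems.FluctuationComparisonRegPrIntLS2BetaChartReadDerivBkgTelescope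

open Literature.MathematicalPhysics.QuantumFieldTheory.Balaban1983to89

variable {P : Params} {E : Type*} [SeminormedAddCommGroup E]

/-- ★★ **THE TELESCOPE OF TWO COMPOSITE LINEAR TOWERS BY SEGMENT ROWS.** [cite: Balaban1985Averaging, Prop. 4 (128)-(131) pp.37-38] -/
theorem norm_sub_telescope_le (k : ℕ) (Y : PBond P 0 → E) (s : ℝ)
    (A B : (i : ℕ) → (PBond P i → E) → (PBond P (i + 1) → E))
    (Aseg : (i k : ℕ) → (PBond P i → E) → (PBond P k → E))
    (Bk : (i : ℕ) → (PBond P 0 → E) → (PBond P i → E))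
    (Λ : ℝ) (ΛB β : ℕ → ℝ)
    (hsegadd : ∀ i, i ≤ k → ∀ Z Z' : PBond P i → E, Aseg i k (fun b => Z b - Z' b) = fun c => Aseg i k Z c - Aseg i k Z' c)
    (hseg : ∀ i, i ≤ k → ∀ (Z : PBond P i → E) (t : ℝ), (∀ b, ‖Z b‖ ≤ t) → ∀ c, ‖Aseg i k Z c‖ ≤ Λ * (P.L : ℝ) ^ (k - i) * t)
    (hsegsucc : ∀ i, i < k → ∀ Z, Aseg i k Z = Aseg (i + 1) k (A i Z)) (hsegkk : ∀ Z, Aseg k k Z = Z)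
    (hBks : ∀ i, i < k → Bk (i + 1) Y = B i (Bk i Y))
    (hBrow : ∀ i, i < k → ∀ b, ‖Bk i Y b‖ ≤ ΛB i * s)
    (hdiff : ∀ i, i < k → ∀ (Z : PBond P i → E) (t : ℝ), (∀ b, ‖Z b‖ ≤ t) → ∀ c, ‖A i Z c - B i Z c‖ ≤ β i * t)
    (c : PBond P k) :
    ‖Aseg 0 k (Bk 0 Y) c - Bk k Y c‖ ≤ ∑ i ∈ Finset.range k, Λ * (P.L : ℝ) ^ (k - 1 - i) * (β i * (ΛB i * s)) := by
  -- descending induction: for every `i ≤ k`, `‖Aseg i k (Bk i Y) c − Bk k Y c‖ ≤ Σ_{j ∈ [i,k)} Λ·L^{k−1−j}·β_j·ΛB_j·s`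
  have key : ∀ n i, i + n = k → ‖Aseg i k (Bk i Y) c - Bk k Y c‖ ≤ ∑ j ∈ Finset.Ico i k, Λ * (P.L : ℝ) ^ (k - 1 - j) * (β j * (ΛB j * s)) := by
    intro n
    induction n with
    | zero =>
      intro i hi
      rw [Nat.add_zero] at hi
      subst hi
      rw [hsegkk, sub_self, norm_zero, Finset.Ico_self, Finset.sum_empty]
    | succ n ih =>
      intro i hi
      have hik : i < k := by omega
      have hrec := ih (i + 1) (by omega)
      -- `Aseg i k (Bk i Y) − Bk k Y = (Aseg (i+1) k (Bk (i+1) Y) − Bk k Y) + Aseg (i+1) k (A i (Bk i Y) − B i (Bk i Y))`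
      have hsplit : Aseg i k (Bk i Y) c - Bk k Y c =
          (Aseg (i + 1) k (Bk (i + 1) Y) c - Bk k Y c) + Aseg (i + 1) k (fun b => A i (Bk i Y) b - B i (Bk i Y) b) c := by
        rw [hsegsucc i hik, hsegadd (i + 1) (by omega), hBks i hik]; dsimp only; abel
      rw [hsplit, Finset.sum_eq_sum_Ico_succ_bot hik, add_comm (Λ * (P.L : ℝ) ^ (k - 1 - i) * (β i * (ΛB i * s)))]
      refine (norm_add_le _ _).trans (add_le_add hrec ?_)
      have hd : ∀ b, ‖A i (Bk i Y) b - B i (Bk i Y) b‖ ≤ β i * (ΛB i * s) := fun b => hdiff i hik (Bk i Y) (ΛB i * s) (hBrow i hik) b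
      have h := hseg (i + 1) (by omega) (fun b => A i (Bk i Y) b - B i (Bk i Y) b) (β i * (ΛB i * s)) hd c
      rwa [show k - (i + 1) = k - 1 - i by omega] at h
  have h := key k 0 (by omega)
  rwa [Finset.range_eq_Ico]

/-- ★ The same with `Bk 0 Y = Y`. [cite: Balaban1985Averaging, Prop. 4 (128)-(131) pp.37-38] -/
theorem norm_sub_telescope_le' (k : ℕ) (Y : PBond P 0 → E) (s : ℝ)
    (A B : (i : ℕ) → (PBond P i → E) → (PBond P (i + 1) → E))
    (Aseg : (i k : ℕ) → (PBond P i → E) → (PBond P k → E))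
    (Bk : (i : ℕ) → (PBond P 0 → E) → (PBond P i → E))
    (Λ : ℝ) (ΛB β : ℕ → ℝ)
    (hsegadd : ∀ i, i ≤ k → ∀ Z Z' : PBond P i → E, Aseg i k (fun b => Z b - Z' b) = fun c => Aseg i k Z c - Aseg i k Z' c)
    (hseg : ∀ i, i ≤ k → ∀ (Z : PBond P i → E) (t : ℝ), (∀ b, ‖Z b‖ ≤ t) → ∀ c, ‖Aseg i k Z c‖ ≤ Λ * (P.L : ℝ) ^ (k - i) * t)
    (hsegsucc : ∀ i, i < k → ∀ Z, Aseg i k Z = Aseg (i + 1) k (A i Z)) (hsegkk : ∀ Z, Aseg k k Z = Z)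
    (hBk0 : Bk 0 Y = Y) (hBks : ∀ i, i < k → Bk (i + 1) Y = B i (Bk i Y))
    (hBrow : ∀ i, i < k → ∀ b, ‖Bk i Y b‖ ≤ ΛB i * s)
    (hdiff : ∀ i, i < k → ∀ (Z : PBond P i → E) (t : ℝ), (∀ b, ‖Z b‖ ≤ t) → ∀ c, ‖A i Z c - B i Z c‖ ≤ β i * t)
    (c : PBond P k) :
    ‖Aseg 0 k Y c - Bk k Y c‖ ≤ ∑ i ∈ Finset.range k, Λ * (P.L : ℝ) ^ (k - 1 - i) * (β i * (ΛB i * s)) := by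
  have h := norm_sub_telescope_le k Y s A B Aseg Bk Λ ΛB β hsegadd hseg hsegsucc hsegkk hBks hBrow hdiff c
  rwa [hBk0] at h

end Summit.QuantumFields.YangMills.Theorems.FluctuationComparisonRegPrIntLS2BetaChartReadDerivBkgTelescope
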